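import Summits.NavierStokesRegularity.NavierStokesRegularity.Theorems.FilamentSkeletonRssDefectColumnGateDefsR

/-!
# DRAFT TEXTS (LEAD ns-filament-21221-p1 g14, 2026-08-29) for the daylight option B2′-sym «NoExactProfileNearSymmetricPair» (tenure g27 T3i-OPTIONS-DRAFT v2 74975d6721706971)
# — NOT filed, NOT a route decl; for the tenure successor's typing and idea-crit-7's stamp.  Crux-dir scratch of crux stmt-21221 (LEAD write slot).

SHAPE (why these quantifiers).  `TransverseReduction1AR` (23611) = ∀ constants (… η …) ∃Γ₁ ∀Γ ≥ Γ₁ ∀ admissible clause-13-R skeleton ∃ (α₁, C₀, M, U, P), `Concl1` (exact profile,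
window-close at tolerance `η√Γ`).  A NEGATIVE theorem refuting it on the symmetric-pair class must (i) quantify over EXACTLY the hypothesis block `DefU1 … Clauses1R` (N = 2) plus a
SYMMETRY clause, (ii) produce SOME tolerance `η > 0` (not all: for huge `η` the window clause is void and the statement would be the open Liouville problem for RSS profiles),
(iii) negate EXACTLY `∃ (α₁ C₀ M U P), Concl1 …`.  Then `B2′-sym ∧ (symmetric admissible pairs exist for all large Γ) ⇒ ¬ TransverseReduction1AR` is pure logic
(`not_transverseReduction1AR_of_draft`, kernel-checked below, no sorry).  The ANALYSIS of B2′-sym (Green identity `vorticity_lagrange_identity` p693934 + exit-flux positivity,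
LEAD 03:40Z (LD-a)/(LD-b)) is NOT here.
HONEST FRAMING: draft statements on the NEGATIVE side of a HYPOTHETICAL filament-type RSS blow-up route (MODEL rung); nothing is asserted; 23611/23920 OPEN; NS regularity NOT proved.
-/

set_option linter.dupNamespace false

noncomputable section

namespace Summit.NavierStokesRegularity.NavierStokesRegularity.Cruxes.TransverseReductionRJ.B2symDraft

open scoped BigOperators Topology InnerProductSpace
open Filter Set Function
open Literature.Analysis.FluidPDE
open Summit.NavierStokesRegularity.NavierStokesRegularity.Theses.FilamentSkeletonRss
open Summit.NavierStokesRegularity.NavierStokesRegularity.Theorems.DefectColumnGate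

/-- Rotation by `π` about the `e₃`-axis: `R_π y = 2⟪y, e₃⟫e₃ − y`. -/
def rotPi (y : EuclideanSpace ℝ (Fin 3)) : EuclideanSpace ℝ (Fin 3) :=
  (2 * ⟪y, EuclideanSpace.single 2 (1:ℝ)⟫_ℝ) • EuclideanSpace.single 2 (1:ℝ) - y

/-- SYMMETRY CLAUSE for a pair (`N = 2`): filament 1 is the `R_π`-image of filament 0, with the same circulation, waist parameter, axial speed and core area
(the R_π datum of the route's MODEL rung). -/
def SymmPair (γ : Fin 2 → ℝ) (X : Fin 2 → ℝ → EuclideanSpace ℝ (Fin 3)) (w : Fin 2 → ℝ → ℝ) (c : Fin 2 → ℝ) (Aa : Fin 2 → ℝ → ℝ) : Prop :=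
  γ 1 = γ 0 ∧ c 1 = c 0 ∧ (∀ τ, X 1 τ = rotPi (X 0 τ)) ∧ (∀ τ, w 1 τ = w 0 τ) ∧ (∀ τ, Aa 1 τ = Aa 0 τ)

/-- **DRAFT B2′-sym `NoExactProfileNearSymmetricPair`**: for all box constants there are a tolerance `η > 0` and a threshold `Γ₂` such that for `Γ ≥ Γ₂` NO admissible
clause-13-R SYMMETRIC PAIR skeleton carries an exact decaying rotating-Leray profile window-close at tolerance `η√Γ` (the negation of 23611's conclusion block `Concl1`,
hypotheses VERBATIM `DefU1 … Clauses1R` with `N = 2`, plus `SymmPair`). -/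
def NoExactProfileNearSymmetricPairDraft : Prop :=
  ∀ (δ ρ K Λ a b cnd Rw Rb cg θ₀ KA : ℝ), 0 < δ → 0 < ρ → 0 ≤ a → 0 < Rw → 0 < Rb → 0 < cg → 0 < θ₀ →
    ∃ η : ℝ, 0 < η ∧ ∃ Γ₂ : ℝ, ∀ Γ : ℝ, Γ₂ ≤ Γ →
    ∀ (γ : Fin 2 → ℝ) (α : ℝ) (X : Fin 2 → ℝ → EuclideanSpace ℝ (Fin 3)) (w : Fin 2 → ℝ → ℝ) (c : Fin 2 → ℝ) (m n : Fin 2 → EuclideanSpace ℝ (Fin 3))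
      (Aa : Fin 2 → ℝ → ℝ) (u : (Fin 2 → ℝ → EuclideanSpace ℝ (Fin 3)) → EuclideanSpace ℝ (Fin 3) → EuclideanSpace ℝ (Fin 3))
      (v : EuclideanSpace ℝ (Fin 3) → EuclideanSpace ℝ (Fin 3)) (A : Fin 2 → (EuclideanSpace ℝ (Fin 3) →L[ℝ] EuclideanSpace ℝ (Fin 3)))
      (T : (Fin 2 → ℝ → EuclideanSpace ℝ (Fin 3)) → Fin 2 → ℝ → EuclideanSpace ℝ (Fin 3)),
      DefU1 2 Γ γ Aa u → DefV1 2 α X u v → DefA1 2 X c v A → DefT1 2 α u T → Clauses1R 2 Γ δ ρ K Λ a b cnd Rw Rb cg θ₀ KA γ α X w c m n Aa v A T →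
      SymmPair γ X w c Aa →
      ¬ ∃ (α₁ C₀ M : ℝ) (U : EuclideanSpace ℝ (Fin 3) → EuclideanSpace ℝ (Fin 3)) (P : EuclideanSpace ℝ (Fin 3) → ℝ), Concl1 2 Γ ρ η Rw X u α₁ C₀ M U P

/-- **DRAFT inhabitation `SymmetricPairSkeletaExist`** (the ∃-side's datum as a Γ-family): for SOME box constants, for all large `Γ`, an admissible clause-13-R symmetric pair
skeleton exists. -/
def SymmetricPairSkeletaExistDraft : Prop :=
  ∃ (δ ρ K Λ a b cnd Rw Rb cg θ₀ KA : ℝ), 0 < δ ∧ 0 < ρ ∧ 0 ≤ a ∧ 0 < Rw ∧ 0 < Rb ∧ 0 < cg ∧ 0 < θ₀ ∧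
    ∃ Γ₀ : ℝ, ∀ Γ : ℝ, Γ₀ ≤ Γ →
    ∃ (γ : Fin 2 → ℝ) (α : ℝ) (X : Fin 2 → ℝ → EuclideanSpace ℝ (Fin 3)) (w : Fin 2 → ℝ → ℝ) (c : Fin 2 → ℝ) (m n : Fin 2 → EuclideanSpace ℝ (Fin 3))
      (Aa : Fin 2 → ℝ → ℝ) (u : (Fin 2 → ℝ → EuclideanSpace ℝ (Fin 3)) → EuclideanSpace ℝ (Fin 3) → EuclideanSpace ℝ (Fin 3))
      (v : EuclideanSpace ℝ (Fin 3) → EuclideanSpace ℝ (Fin 3)) (A : Fin 2 → (EuclideanSpace ℝ (Fin 3) →L[ℝ] EuclideanSpace ℝ (Fin 3)))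
      (T : (Fin 2 → ℝ → EuclideanSpace ℝ (Fin 3)) → Fin 2 → ℝ → EuclideanSpace ℝ (Fin 3)),
      DefU1 2 Γ γ Aa u ∧ DefV1 2 α X u v ∧ DefA1 2 X c v A ∧ DefT1 2 α u T ∧ Clauses1R 2 Γ δ ρ K Λ a b cnd Rw Rb cg θ₀ KA γ α X w c m n Aa v A T ∧
      SymmPair γ X w c Aa

/-- **GLUE (pure logic, no sorry): B2′-sym + inhabitation REFUTE the ∀-crux `TransverseReduction1AR` (stmt-23611).** -/
theorem not_transverseReduction1AR_of_draft (hB : NoExactProfileNearSymmetricPairDraft) (hE : SymmetricPairSkeletaExistDraft) :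
    ¬ TransverseReduction1AR := by
  intro hTR
  obtain ⟨δ, ρ, K, Λ, a, b, cnd, Rw, Rb, cg, θ₀, KA, hδ, hρ, ha, hRw, hRb, hcg, hθ₀, Γ₀, hex⟩ := hE
  obtain ⟨η, hη, Γ₂, hB'⟩ := hB δ ρ K Λ a b cnd Rw Rb cg θ₀ KA hδ hρ ha hRw hRb hcg hθ₀
  obtain ⟨Γ₁, hTR'⟩ := (transverseReduction1AR_iff.mp hTR) 2 δ ρ K Λ a b cnd η Rw Rb cg θ₀ KA (by norm_num) hδ hρ ha hη hRw hRb hcg hθ₀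
  set Γ : ℝ := max Γ₀ (max Γ₁ Γ₂) with hΓ
  obtain ⟨γ, α, X, w, c, m, n, Aa, u, v, A, T, hu, hv, hA, hT, hcl, hsym⟩ := hex Γ (le_max_left _ _)
  have h1 : Γ₁ ≤ Γ := le_trans (le_max_left _ _) (le_max_right _ _)
  have h2 : Γ₂ ≤ Γ := le_trans (le_max_right _ _) (le_max_right _ _)
  exact hB' Γ h2 γ α X w c m n Aa u v A T hu hv hA hT hcl hsym (hTR' Γ h1 γ α X w c m n Aa u v A T hu hv hA hT hcl)

/-! ## RE-CUT №2 (LEAD 04:28Z / 04:5xZ): ONE negative item on the WHOLE admissible class, any `N` — the union cut-off makes transfers irrelevant -/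

/-- **DRAFT B2′ `NoExactProfileNearSkeleton`**: for all box constants there are a tolerance `η > 0` and a threshold `Γ₂` such that for `Γ ≥ Γ₂` NO admissible clause-13-R
skeleton (any `N ≥ 1`) carries an exact decaying rotating-Leray profile window-close at tolerance `η√Γ` — the negation of 23611's conclusion block `Concl1` on the whole class,
hypotheses VERBATIM.  (Proof plan, not here: `flux_balance_of_exact_profile` with a cut-off of the whole skeleton window + the far-field sign step (γ).) -/
def NoExactProfileNearSkeletonDraft : Prop :=
  ∀ (N : ℕ) (δ ρ K Λ a b cnd Rw Rb cg θ₀ KA : ℝ), 0 < N → 0 < δ → 0 < ρ → 0 ≤ a → 0 < Rw → 0 < Rb → 0 < cg → 0 < θ₀ →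
    ∃ η : ℝ, 0 < η ∧ ∃ Γ₂ : ℝ, ∀ Γ : ℝ, Γ₂ ≤ Γ →
    ∀ (γ : Fin N → ℝ) (α : ℝ) (X : Fin N → ℝ → EuclideanSpace ℝ (Fin 3)) (w : Fin N → ℝ → ℝ) (c : Fin N → ℝ) (m n : Fin N → EuclideanSpace ℝ (Fin 3))
      (Aa : Fin N → ℝ → ℝ) (u : (Fin N → ℝ → EuclideanSpace ℝ (Fin 3)) → EuclideanSpace ℝ (Fin 3) → EuclideanSpace ℝ (Fin 3))
      (v : EuclideanSpace ℝ (Fin 3) → EuclideanSpace ℝ (Fin 3)) (A : Fin N → (EuclideanSpace ℝ (Fin 3) →L[ℝ] EuclideanSpace ℝ (Fin 3)))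
      (T : (Fin N → ℝ → EuclideanSpace ℝ (Fin 3)) → Fin N → ℝ → EuclideanSpace ℝ (Fin 3)),
      DefU1 N Γ γ Aa u → DefV1 N α X u v → DefA1 N X c v A → DefT1 N α u T → Clauses1R N Γ δ ρ K Λ a b cnd Rw Rb cg θ₀ KA γ α X w c m n Aa v A T →
      ¬ ∃ (α₁ C₀ M : ℝ) (U : EuclideanSpace ℝ (Fin 3) → EuclideanSpace ℝ (Fin 3)) (P : EuclideanSpace ℝ (Fin 3) → ℝ), Concl1 N Γ ρ η Rw X u α₁ C₀ M U P

/-- **DRAFT inhabitation `AdmissibleSkeletaExist`** (the ∃-side datum as a Γ-family, any fixed `N`). -/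
def AdmissibleSkeletaExistDraft : Prop :=
  ∃ (N : ℕ) (δ ρ K Λ a b cnd Rw Rb cg θ₀ KA : ℝ), 0 < N ∧ 0 < δ ∧ 0 < ρ ∧ 0 ≤ a ∧ 0 < Rw ∧ 0 < Rb ∧ 0 < cg ∧ 0 < θ₀ ∧
    ∃ Γ₀ : ℝ, ∀ Γ : ℝ, Γ₀ ≤ Γ →
    ∃ (γ : Fin N → ℝ) (α : ℝ) (X : Fin N → ℝ → EuclideanSpace ℝ (Fin 3)) (w : Fin N → ℝ → ℝ) (c : Fin N → ℝ) (m n : Fin N → EuclideanSpace ℝ (Fin 3))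
      (Aa : Fin N → ℝ → ℝ) (u : (Fin N → ℝ → EuclideanSpace ℝ (Fin 3)) → EuclideanSpace ℝ (Fin 3) → EuclideanSpace ℝ (Fin 3))
      (v : EuclideanSpace ℝ (Fin 3) → EuclideanSpace ℝ (Fin 3)) (A : Fin N → (EuclideanSpace ℝ (Fin 3) →L[ℝ] EuclideanSpace ℝ (Fin 3)))
      (T : (Fin N → ℝ → EuclideanSpace ℝ (Fin 3)) → Fin N → ℝ → EuclideanSpace ℝ (Fin 3)),
      DefU1 N Γ γ Aa u ∧ DefV1 N α X u v ∧ DefA1 N X c v A ∧ DefT1 N α u T ∧ Clauses1R N Γ δ ρ K Λ a b cnd Rw Rb cg θ₀ KA γ α X w c m n Aa v A T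

/-- **GLUE (pure logic, no sorry): B2′ + inhabitation REFUTE `TransverseReduction1AR` (stmt-23611).** -/
theorem not_transverseReduction1AR_of_noExactProfile (hB : NoExactProfileNearSkeletonDraft) (hE : AdmissibleSkeletaExistDraft) :
    ¬ TransverseReduction1AR := by
  intro hTR
  obtain ⟨N, δ, ρ, K, Λ, a, b, cnd, Rw, Rb, cg, θ₀, KA, hN, hδ, hρ, ha, hRw, hRb, hcg, hθ₀, Γ₀, hex⟩ := hE
  obtain ⟨η, hη, Γ₂, hB'⟩ := hB N δ ρ K Λ a b cnd Rw Rb cg θ₀ KA hN hδ hρ ha hRw hRb hcg hθ₀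
  obtain ⟨Γ₁, hTR'⟩ := (transverseReduction1AR_iff.mp hTR) N δ ρ K Λ a b cnd η Rw Rb cg θ₀ KA hN hδ hρ ha hη hRw hRb hcg hθ₀
  obtain ⟨γ, α, X, w, c, m, n, Aa, u, v, A, T, hu, hv, hA, hT, hcl⟩ := hex (max Γ₀ (max Γ₁ Γ₂)) (le_max_left _ _)
  have h1 : Γ₁ ≤ max Γ₀ (max Γ₁ Γ₂) := le_trans (le_max_left _ _) (le_max_right _ _)
  have h2 : Γ₂ ≤ max Γ₀ (max Γ₁ Γ₂) := le_trans (le_max_right _ _) (le_max_right _ _)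
  exact hB' _ h2 γ α X w c m n Aa u v A T hu hv hA hT hcl (hTR' _ h1 γ α X w c m n Aa u v A T hu hv hA hT hcl)

end Summit.NavierStokesRegularity.NavierStokesRegularity.Cruxes.TransverseReductionRJ.B2symDraft

end
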